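import Mathlib.RingTheory.Ideal.Operations
import Mathlib.RingTheory.LocalRing.MaximalIdeal.Basic
import Mathlib.Algebra.BigOperators.Group.Finset.Basic
import HarnessLib

/-!
# [OURS · L1 W4.5(b) · S6 (L) brick C3⁺, ring cores (R-a)–(R-c)] Generators modulo the square of an ideal: unit rescaling, units
# modulo an ideal in a local ring, and finite sums

Cell res-hironaka, LADDER-RESOLUTION rung L, slot W4.5(b), crux chain w45b: EL♮(3) = stmt-ResolutionOfSingularities-20148, S6 (L) `hL` brick C3⁺
(res-L1-w45b-stub-4 g9 sub-skeleton `DirLiftSkeleton-v2.lean` db5114efb4ea3c7d; the stalk-level endgames of (C3-iii) `dirLift_chartColumn_compat`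
«`span{c′} ⊔ I_p² = span{t̃ c} ⊔ I_p² = span{c} ⊔ I_p²`, `t̃ t̃′ − 1 ∈ I_p ≤ 𝔪_p`» and of (C3-iv) `dirLift_chartColumn_reduction`
«`j₀♯A_l ≡ λ̃ Σ α_j j₀♯N_jl (mod Ī)` ⇒ `j₀♯c ≡ λ̃ Σ α_j x^p_j (mod Ī·Ī)`»). res-D-pv-036 g11 DECLINE of the scheme-level (C3-iv) with the
offer «ring cores (R-a)–(R-c) by signature» (STATUS 2026-08-27T23:16:47Z). `--supports stmt-ResolutionOfSingularities-20148 --as helper`. NOT a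
statement of any manuscript; OURS; AI-written, weaker than expert review. Definition-free; Mathlib-only; standard axioms.

* (R-a) `span_singleton_sup_eq_of_sub_mul_mem` — `c − u·c′ ∈ K`, `u` a unit ⇒ `(c) + K = (c′) + K`; `span_singleton_sup_sq_eq_of_sub_mul_mem` — the
  case `K = J²`.
* (R-b) `isUnit_of_mul_sub_one_mem` — in a local ring, `t·t′ − 1 ∈ J ⊆ 𝔪 ⇒ t` is a unit (and `t′`).
* (R-c) `sum_mul_sub_mul_sum_mul_mem_sq` — `α_j − u·α′_j ∈ J` and `x_j ∈ J` for all `j` ⇒ `Σ α_j x_j − u·Σ α′_j x_j ∈ J²`; with (R-a):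
  `span_sum_mul_sup_sq_eq` — `(Σ α_j x_j) + J² = (Σ α′_j x_j) + J²` when moreover `u` is a unit.
[folklore]
-/

set_option linter.dupNamespace false

open scoped BigOperators

namespace Summit.ResolutionOfSingularities.ResolutionOfSingularities.Cruxes.EquisingularLiftNat.Sections

variable {R : Type*} [CommRing R]

/-- **(R-a) Unit rescaling modulo an ideal**: `c − u·c′ ∈ K` with `u` a unit ⇒ `(c) + K = (c′) + K`. [folklore] -/
theorem span_singleton_sup_eq_of_sub_mul_mem (K : Ideal R) {c c' u : R} (hu : IsUnit u) (h : c - u * c' ∈ K) :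
    Ideal.span {c} ⊔ K = Ideal.span {c'} ⊔ K := by
  apply le_antisymm
  · refine sup_le ?_ le_sup_right
    rw [Ideal.span_le, Set.singleton_subset_iff]
    have hc : c = u * c' + (c - u * c') := by ring
    rw [SetLike.mem_coe, hc]
    exact add_mem (Ideal.mem_sup_left (Ideal.mem_span_singleton'.mpr ⟨u, rfl⟩)) (Ideal.mem_sup_right h)
  · refine sup_le ?_ le_sup_right
    rw [Ideal.span_le, Set.singleton_subset_iff]
    obtain ⟨v, rfl⟩ := hu
    have hc' : c' = (↑v⁻¹ : R) * c - (↑v⁻¹ : R) * (c - v * c') := by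
      rw [mul_sub, ← mul_assoc, Units.inv_mul, one_mul]
      ring
    rw [SetLike.mem_coe, hc']
    exact sub_mem (Ideal.mem_sup_left (Ideal.mem_span_singleton'.mpr ⟨_, rfl⟩)) (Ideal.mem_sup_right (K.mul_mem_left _ h))

/-- (R-a), the square of an ideal: `c − u·c′ ∈ J²`, `u` a unit ⇒ `(c) + J² = (c′) + J²`. [folklore] -/
theorem span_singleton_sup_sq_eq_of_sub_mul_mem (J : Ideal R) {c c' u : R} (hu : IsUnit u) (h : c - u * c' ∈ J ^ 2) :
    Ideal.span {c} ⊔ J ^ 2 = Ideal.span {c'} ⊔ J ^ 2 :=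
  span_singleton_sup_eq_of_sub_mul_mem (J ^ 2) hu h

/-- **(R-b) A unit modulo an ideal inside the maximal ideal is a unit**: `R` local, `J ⊆ 𝔪`, `t·t′ − 1 ∈ J` ⇒ `t` is a unit. [folklore] -/
theorem isUnit_of_mul_sub_one_mem [IsLocalRing R] (J : Ideal R) (hJ : J ≤ IsLocalRing.maximalIdeal R) {t t' : R}
    (h : t * t' - 1 ∈ J) : IsUnit t := by
  by_contra ht
  have htm : t ∈ IsLocalRing.maximalIdeal R := (IsLocalRing.mem_maximalIdeal t).mpr ht
  have h1 : (1 : R) ∈ IsLocalRing.maximalIdeal R := by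
    have e : (1 : R) = t * t' - (t * t' - 1) := by ring
    rw [e]
    exact sub_mem (Ideal.mul_mem_right _ _ htm) (hJ h)
  exact (IsLocalRing.maximalIdeal.isMaximal R).ne_top ((Ideal.eq_top_iff_one _).mpr h1)

/-- (R-b), symmetric: also `t′` is a unit. [folklore] -/
theorem isUnit_of_mul_sub_one_mem' [IsLocalRing R] (J : Ideal R) (hJ : J ≤ IsLocalRing.maximalIdeal R) {t t' : R}
    (h : t * t' - 1 ∈ J) : IsUnit t' :=
  isUnit_of_mul_sub_one_mem J hJ (t := t') (t' := t) (by rw [mul_comm]; exact h)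

/-- **(R-c) Finite sums**: `α_j − u·α′_j ∈ J` and `x_j ∈ J` for all `j` ⇒ `Σ α_j x_j − u·Σ α′_j x_j ∈ J²`. [folklore] -/
theorem sum_mul_sub_mul_sum_mul_mem_sq (J : Ideal R) {ι : Type*} (s : Finset ι) {α α' x : ι → R} (u : R)
    (hα : ∀ j ∈ s, α j - u * α' j ∈ J) (hx : ∀ j ∈ s, x j ∈ J) :
    (∑ j ∈ s, α j * x j) - u * ∑ j ∈ s, α' j * x j ∈ J ^ 2 := by
  have e : (∑ j ∈ s, α j * x j) - u * ∑ j ∈ s, α' j * x j = ∑ j ∈ s, (α j - u * α' j) * x j := by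
    rw [Finset.mul_sum, ← Finset.sum_sub_distrib]
    refine Finset.sum_congr rfl fun j _ => by ring
  rw [e, pow_two]
  exact Submodule.sum_mem _ fun j hj => Ideal.mul_mem_mul (hα j hj) (hx j hj)

/-- (R-c) with (R-a): `(Σ α_j x_j) + J² = (Σ α′_j x_j) + J²` when `α_j − u·α′_j ∈ J`, `x_j ∈ J`, `u` a unit. [folklore] -/
theorem span_sum_mul_sup_sq_eq (J : Ideal R) {ι : Type*} (s : Finset ι) {α α' x : ι → R} {u : R} (hu : IsUnit u)
    (hα : ∀ j ∈ s, α j - u * α' j ∈ J) (hx : ∀ j ∈ s, x j ∈ J) :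
    Ideal.span {∑ j ∈ s, α j * x j} ⊔ J ^ 2 = Ideal.span {∑ j ∈ s, α' j * x j} ⊔ J ^ 2 :=
  span_singleton_sup_sq_eq_of_sub_mul_mem J hu (sum_mul_sub_mul_sum_mul_mem_sq J s u hα hx)

end Summit.ResolutionOfSingularities.ResolutionOfSingularities.Cruxes.EquisingularLiftNat.Sections
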